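/-
Copyright: the b2b-balaban cell (near-miss cell 7), T⁴-continuum fan-out; row NE7b ROUND-2 swarm, seat
t4-ne7b-formalise-leaf-05 gen 3 (row S6g′ INSTANCE of `t4/b2b-balaban-t4-ne7b-p1/LEAVES-NE7b.md`, owner's ruling
R-OWNER-22-20 (2)).  Released under the licence of the surrounding project.
-/
import Summits.QuantumFields.BalabanUV.T4Continuum.Support.HistorySiblingEntropyRenew
import Summits.QuantumFields.BalabanUV.T4Continuum.Support.HistoryBankingLE

/-!
# The renewal count is class-linear, COST SIDE: `NR·φ ≤ totalCostT` (row S6g′, instance sub-item «INST-NR»)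

Summits-side support leaf of the T⁴-continuum cell (rung (B)+1 on a FINITE torus only; NOT infinite volume, NOT the
mass gap, NOT the Clay statement; NOT a proof of the spine estimate NE7b).  Row NE7b, route «COUNT», row S6g′
«MASS-BASED SIBLING COUNT», the instance's first sub-item (owner's ruling R-OWNER-22-20 (2)).  [folklore] structural and
well-founded recursion over the lineage's own carrier `T4PersistenceDictionary.Gen` plus the nonnegativity of leaf-02's
booked costs `HistoryBankingLE.{evCost, totalCostT}`; nothing is quoted from print, nothing printed is asserted, no
`[cite:]` tag, no `Prop` fact minted (the one definition below is a counting FUNCTION).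

WHY.  Leaf-10 gen 3's renewal-recording entropy END `HistorySiblingEntropyBridge.ENT_leR` pays `8·NR st G` — the number
of renewal nodes of the member, BY NAME — and leaves «is `NR` class-linear?» to the instance.  On the LE road the class
key is the member's TOTAL BOOKED COST `totalCostT sh C K R G` (every event's whole window floor and size epoch) together
with its birth mass; a renewal label of a `ConsistentTLE` member has kind `1`, is placed at its own step `h + 1 ≤ K`
(a PERFORMED step — `ConsistentTLE`'s renewal clause), and therefore books at least the floor of that one step,
`floorK C K R (h + 1) = E₂·R_{h+1}^{q′}`; on a FRESH member the renewal labels are pairwise distinct events, so the floors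
add up inside `totalCostT` (exact additivity `totalCostT_renew` ∕ `totalCostT_merge`, all other summands `≥ 0`).  Hence
`NR·φ ≤ totalCostT` for every lower bound `φ` of the performed floors — `φ = E₂` when `R ≥ 1` on the run, `φ = E₂·Rm^{q′}`
when `R ≥ Rm` on the run.  Under `ConsistentTLE` there are NO terminal-step renewals (`h + 1 ≤ K` always), so the
`+ bsum 1 G` term of the owner's sketch is not needed.

WHAT.  §1 `nrenew` (structural count), `nrenew_eq_sum_clusterParts`, **`NR_eq_nrenew`** (the binding's `NR`, read
through the joins' part lists, IS the structural count — like `HistoryJoinsEnd.mrg_eq_nmerges`).  §2 `le_floorK_of_le`,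
`floorK_le_evCost_renew` (a performed renewal books at least its step's floor), `totalCostT_nonneg`,
**`nrenew_mul_le_totalCostT`**: `FreshT G → ConsistentTLE sh C K R G → (∀ n ≤ K, φ ≤ floorK C K R n) → 0 ≤ φ →
nrenew G · φ ≤ totalCostT sh C K R G`, and its two readings **`nrenew_mul_E₂_le_totalCostT`** (`R ≥ 1` on the run) ∕
`nrenew_mul_E₂_pow_le_totalCostT` (`R ≥ Rm` on the run).  §3 In the binding's letters: **`NR_le_totalCostT_div`**
(`NR st G ≤ totalCostT ∕ φ`) and the END **`ENT_leRC`**: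
`Mono st G → InjPartsR st fat G → FreshT G → ConsistentTLE sh C K R G → (floors ≥ φ > 0 on the run) →
 ENT st G ≤ 2·bsum (1 + fat) G + 4·partnerAges st G + 8·mrg st G + (8 ∕ φ)·totalCostT sh C K R G`
— CLASS-LINEAR in (birth mass, partner ages, part count, total booked cost); **`ENT_leRC_genT`** on pedigrees
(`HeadOldest` + `Forest` + the member's `ConsistentTLE` + `InjPartsR`).  §4 Sanity: the count on leaf-02's early
renewal (`NR = nrenew = 1`, and `1·E₂ ≤ totalCostT` instantiated).

HONEST SCOPE.  Displayed, with named suppliers: `InjPartsR` (canonical order ∕ labels — row S1c), the member's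
`ConsistentTLE` (H1b: `HistoryRealiseTimed.consistentTLE_genT_of_realises`) and `FreshT` (`HistoryGenFresh.freshT_genT`),
`R ≥ 1` on the run (the flow).  CONSTANT CHECK left to the instance's END (R-OWNER-22-20): the factor `exp((8∕φ)·T)` must
be absorbed by the per-unit-cost margin of the LE exit; this file only supplies the inequality with the best floor `φ`
the run affords.  Nothing of H3∕(B)∕BetaPertH touched; `BirthShapeNodup` NOT retired here; NE7b NOT proved.  HONEST
DEPENDENCY (cell): continuum YM on T⁴ ⇐ BetaPertH ∧ nine spine estimates (0/9 proved); BetaPertH ⇐ (D1) ∧ (D4) ∧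
CAP+tail; G-an2-4 gates asym, D1 and NE2/3/4.  This file changes none of it.
-/

open Finset
open Literature.MathematicalPhysics.QuantumFieldTheory.Balaban1983to89
open T4PersistenceDictionary T4PrintedShapeBanking T4TaggedShapeBanking T4PartnerMultiplicity T4BranchingRecordsGas
open Summit.QuantumFields.BalabanUV.T4Continuum.LateMergers
open Summit.QuantumFields.BalabanUV.T4Continuum.HistoryBankingLE
open Summit.QuantumFields.BalabanUV.T4Continuum.HistoryJoins
open Summit.QuantumFields.BalabanUV.T4Continuum.HistoryJoinsAdm
open Summit.QuantumFields.BalabanUV.T4Continuum.HistorySiblingEntropyBridge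
open Summit.QuantumFields.BalabanUV.T4Continuum.HistoryJoinsBudget (mrg)
open Summit.QuantumFields.BalabanUV.T4Continuum.HistoryJoinsEntropyBudget (ENT)

namespace Summit.QuantumFields.BalabanUV.T4Continuum.HistoryRenewalsCost

noncomputable section

variable {ε : Type*}

/-! ## §1 The renewal count, structurally, and `NR = nrenew` -/

/-- **THE NUMBER OF RENEWAL NODES**, by structural recursion. [folklore] -/
def nrenew : Gen ε → ℕ
  | Gen.born _ _ => 0
  | Gen.renew G _ _ => nrenew G + 1
  | Gen.merge X Y _ => nrenew X + nrenew Y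

/-- `nrenew` unfolds [folklore] -/
@[simp] theorem nrenew_born (b : ε) (j : ℕ) : nrenew (Gen.born b j) = 0 := rfl
/-- `nrenew` unfolds [folklore] -/
@[simp] theorem nrenew_renew (G : Gen ε) (e : ε) (h : ℕ) : nrenew (Gen.renew G e h) = nrenew G + 1 := rfl
/-- `nrenew` unfolds [folklore] -/
@[simp] theorem nrenew_merge (X Y : Gen ε) (e : ε) : nrenew (Gen.merge X Y e) = nrenew X + nrenew Y := rfl

variable (st : ε → ℕ)

/-- **RENEWAL COUNTS DECOMPOSE ALONG THE PARTS OF A CLUSTER** (renewals close clusters, so every renewal node sits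
inside exactly one part). [folklore] -/
theorem nrenew_eq_sum_clusterParts (t : ℕ) :
    ∀ G : Gen ε, nrenew G = ((clusterParts st t G).map fun q => nrenew q.2).sum
  | Gen.born b j => by simp
  | Gen.renew G e h => by simp
  | Gen.merge X Y e => by
      by_cases he : st e = t
      · rw [clusterParts_merge_of_eq st he, List.map_append, List.sum_append, List.map_map, List.map_map]
        simp only [nrenew, nrenew_eq_sum_clusterParts t X, nrenew_eq_sum_clusterParts t Y]
        rfl
      · rw [clusterParts_merge_of_ne st he]
        simp

/-- **`NR = nrenew`**: the binding's renewal count (leaf-10 gen 3's `NR`, read through the joins' part lists) IS the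
structural count. [folklore] -/
theorem NR_eq_nrenew : ∀ G : Gen ε, NR st G = nrenew G
  | Gen.born b j => by rw [NR]; rfl
  | Gen.renew G e h => by rw [NR, NR_eq_nrenew G]; rfl
  | Gen.merge X Y e => by
      rw [NR, Finset.sum_congr rfl fun i _ => NR_eq_nrenew (part st (Gen.merge X Y e) i).2,
        sum_parts_eq st _ (fun q => nrenew q.2)]
      have hj : jparts st (Gen.merge X Y e) = clusterParts st (st e) (Gen.merge X Y e) := rfl
      rw [hj, ← nrenew_eq_sum_clusterParts st (st e)]
termination_by G => gsize G
decreasing_by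
  all_goals first
    | (simp only [gsize]; omega)
    | exact gsize_lt_of_mem_jparts st _ _ (part_mem st _ _)

/-- `NR` in `ℝ` [folklore] -/
theorem NR_cast_eq_nrenew (G : Gen ε) : (NR st G : ℝ) = (nrenew G : ℝ) := by rw [NR_eq_nrenew]

/-! ## §2 Every performed renewal books at least its step's floor: `nrenew·φ ≤ totalCostT` -/

section Cost

variable [DecidableEq ε] {sh : ε → PEv} {C : T4PrintedShapeBanking.Consts} {K : ℕ} {R : ℕ → ℕ}

omit [DecidableEq ε] in
/-- a uniform lower bound of the window rate on the run is a uniform lower bound of the performed floors: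
`n ≤ K → Rm ≤ R n → E₂·Rm^{q′} ≤ floorK C K R n`. [folklore] -/
theorem le_floorK_of_le (hE₂ : 0 ≤ C.E₂) {n Rm : ℕ} (hn : n ≤ K) (hRm : Rm ≤ R n) :
    C.E₂ * (Rm : ℝ) ^ C.q' ≤ floorK C K R n := by
  unfold floorK
  rw [if_pos hn]
  exact mul_le_mul_of_nonneg_left (pow_le_pow_left₀ (Nat.cast_nonneg _) (by exact_mod_cast hRm) _) hE₂

omit [DecidableEq ε] in
/-- in particular `R ≥ 1` on the run gives `E₂ ≤ floorK C K R n` for `n ≤ K`. [folklore] -/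
theorem E₂_le_floorK (hE₂ : 0 ≤ C.E₂) {n : ℕ} (hn : n ≤ K) (hR1 : 1 ≤ R n) : C.E₂ ≤ floorK C K R n := by
  have h := le_floorK_of_le (C := C) (K := K) (R := R) hE₂ hn hR1
  simpa using h

omit [DecidableEq ε] in
/-- **A PERFORMED RENEWAL BOOKS AT LEAST ITS STEP'S FLOOR**: a kind-`1` label at step `h + 1`, placed at `h + 1`, has
`floorK C K R (h + 1) ≤ evCost sh C K R (h + 1) e` (its window `[h + 1, h + 2 + R_{h+1})` contains `h + 1`; every
other summand is `≥ 0`). [folklore] -/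
theorem floorK_le_evCost_renew (hE₂ : 0 ≤ C.E₂) (hE₃ : 0 ≤ C.E₃) {e : ε} {h : ℕ} (hk : (sh e).kind = 1)
    (hs : (sh e).step = h + 1) : floorK C K R (h + 1) ≤ evCost sh C K R (h + 1) e := by
  unfold evCost
  have hW : dictWT sh R C.n₁ e = R (h + 1) + 1 := by rw [dictWT_kind1 hk, hs]
  have hmem : h + 1 ∈ Finset.Ico (h + 1) (h + 1 + dictWT sh R C.n₁ e) := by
    rw [Finset.mem_Ico, hW]; omega
  have h1 : floorK C K R (h + 1) ≤ ∑ n ∈ Finset.Ico (h + 1) (h + 1 + dictWT sh R C.n₁ e), floorK C K R n :=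
    Finset.single_le_sum (f := fun n => floorK C K R n) (fun n _ => floorK_nonneg hE₂ n) hmem
  have h2 : 0 ≤ ∑ n ∈ supp C (sh e), sz C K R (sh e) n := Finset.sum_nonneg fun n _ => sz_nonneg hE₃ _ _
  linarith

/-- the total booked cost is nonnegative. [folklore] -/
theorem totalCostT_nonneg (hE₂ : 0 ≤ C.E₂) (hE₃ : 0 ≤ C.E₃) (G : Gen ε) : 0 ≤ totalCostT sh C K R G :=
  Finset.sum_nonneg fun e _ => evCost_nonneg hE₂ hE₃ _ e

omit [DecidableEq ε] in
/-- the merger extension is a booked cost, hence nonnegative. [folklore] -/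
theorem extnT_nonneg (hE₂ : 0 ≤ C.E₂) (hE₃ : 0 ≤ C.E₃) (X Y : Gen ε) (e : ε) : 0 ≤ extnT sh C K R X Y e := by
  rw [← evCost_merge_eq_extnT]
  exact evCost_nonneg hE₂ hE₃ _ e

/-- **THE RENEWAL COUNT IS CLASS-LINEAR, COST SIDE.**  For a FRESH, `ConsistentTLE` member and any uniform lower bound
`φ ≥ 0` of the performed floors (`∀ n ≤ K, φ ≤ floorK C K R n`):  `nrenew G · φ ≤ totalCostT sh C K R G`. [folklore] -/
theorem nrenew_mul_le_totalCostT (hE₂ : 0 ≤ C.E₂) (hE₃ : 0 ≤ C.E₃) {φ : ℝ} (hφ0 : 0 ≤ φ)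
    (hφ : ∀ n, n ≤ K → φ ≤ floorK C K R n) :
    ∀ {G : Gen ε}, FreshT G → ConsistentTLE sh C K R G → (nrenew G : ℝ) * φ ≤ totalCostT sh C K R G
  | Gen.born b j, _, _ => by
      simp only [nrenew_born, Nat.cast_zero, zero_mul]
      exact totalCostT_nonneg hE₂ hE₃ _
  | Gen.renew G e h, hf, hc => by
      simp only [FreshT] at hf
      simp only [ConsistentTLE] at hc
      obtain ⟨hG, hk, hs, -, hK⟩ := hc
      rw [totalCostT_renew hf.2, nrenew_renew, Nat.cast_add, Nat.cast_one, add_mul, one_mul]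
      have ih := nrenew_mul_le_totalCostT hE₂ hE₃ hφ0 hφ hf.1 hG
      have hfl := floorK_le_evCost_renew (K := K) (R := R) hE₂ hE₃ hk hs
      have hφ' := hφ (h + 1) hK
      linarith
  | Gen.merge X Y e, hf, hc => by
      simp only [FreshT] at hf
      obtain ⟨hfX, hfY, heX, heY, hd⟩ := hf
      simp only [ConsistentTLE] at hc
      obtain ⟨hX, hY, -⟩ := hc
      rw [totalCostT_merge heX heY hd, nrenew_merge, Nat.cast_add, add_mul]
      have ihX := nrenew_mul_le_totalCostT hE₂ hE₃ hφ0 hφ hfX hX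
      have ihY := nrenew_mul_le_totalCostT hE₂ hE₃ hφ0 hφ hfY hY
      have hex := extnT_nonneg (sh := sh) (C := C) (K := K) (R := R) hE₂ hE₃ X Y e
      linarith

/-- **READING 1 (`R ≥ 1` on the run)**: `nrenew G · E₂ ≤ totalCostT sh C K R G`. [folklore] -/
theorem nrenew_mul_E₂_le_totalCostT (hE₂ : 0 ≤ C.E₂) (hE₃ : 0 ≤ C.E₃) (hR1 : ∀ n, n ≤ K → 1 ≤ R n) {G : Gen ε}
    (hf : FreshT G) (hc : ConsistentTLE sh C K R G) : (nrenew G : ℝ) * C.E₂ ≤ totalCostT sh C K R G :=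
  nrenew_mul_le_totalCostT hE₂ hE₃ hE₂ (fun n hn => E₂_le_floorK (C := C) hE₂ hn (hR1 n hn)) hf hc

/-- **READING 2 (`R ≥ Rm` on the run)**: `nrenew G · (E₂·Rm^{q′}) ≤ totalCostT sh C K R G` — the better constant when
the window rate has a floor `Rm` on the run. [folklore] -/
theorem nrenew_mul_E₂_pow_le_totalCostT (hE₂ : 0 ≤ C.E₂) (hE₃ : 0 ≤ C.E₃) {Rm : ℕ} (hRm : ∀ n, n ≤ K → Rm ≤ R n)
    {G : Gen ε} (hf : FreshT G) (hc : ConsistentTLE sh C K R G) :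
    (nrenew G : ℝ) * (C.E₂ * (Rm : ℝ) ^ C.q') ≤ totalCostT sh C K R G :=
  nrenew_mul_le_totalCostT hE₂ hE₃ (by positivity) (fun n hn => le_floorK_of_le (C := C) hE₂ hn (hRm n hn)) hf hc

/-! ## §3 In the binding's letters: `NR ≤ totalCostT ∕ φ` and the END `ENT_leRC` -/

/-- **`NR st G ≤ totalCostT sh C K R G ∕ φ`** for a fresh `ConsistentTLE` member and a POSITIVE floor bound `φ`.
[folklore] -/
theorem NR_le_totalCostT_div (hE₂ : 0 ≤ C.E₂) (hE₃ : 0 ≤ C.E₃) {φ : ℝ} (hφ0 : 0 < φ)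
    (hφ : ∀ n, n ≤ K → φ ≤ floorK C K R n) {G : Gen ε} (hf : FreshT G) (hc : ConsistentTLE sh C K R G) :
    (NR st G : ℝ) ≤ totalCostT sh C K R G / φ := by
  rw [NR_cast_eq_nrenew, le_div_iff₀ hφ0]
  exact nrenew_mul_le_totalCostT hE₂ hE₃ hφ0.le hφ hf hc

/-- **THE END WITH THE RENEWALS PAID BY THE BOOKED COST.**  For a fresh `ConsistentTLE` member, under the displays
`Mono` (free on pedigrees) and `InjPartsR` (canonical order ∕ labels, row S1c) and a positive floor bound `φ` on the run:
`ENT st G ≤ 2·bsum (1 + fat) G + 4·partnerAges st G + 8·mrg st G + (8 ∕ φ)·totalCostT sh C K R G` — class-linear in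
(birth mass, partner ages, part count, total booked cost). [folklore] -/
theorem ENT_leRC (fat : ε → ℕ) (hE₂ : 0 ≤ C.E₂) (hE₃ : 0 ≤ C.E₃) {φ : ℝ} (hφ0 : 0 < φ)
    (hφ : ∀ n, n ≤ K → φ ≤ floorK C K R n) (G : Gen ε) (hm : Mono st G) (hi : InjPartsR st fat G) (hf : FreshT G)
    (hc : ConsistentTLE sh C K R G) :
    ENT st G ≤ 2 * bsum (fun b => (1 : ℝ) + fat b) G + 4 * (partnerAges st G : ℝ) + 8 * mrg st G +
      8 / φ * totalCostT sh C K R G := by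
  have h := ENT_leR st fat G hm hi
  have hNR := NR_le_totalCostT_div st hE₂ hE₃ hφ0 hφ hf hc
  have : 8 * (NR st G : ℝ) ≤ 8 / φ * totalCostT sh C K R G := by
    rw [div_mul_eq_mul_div, le_div_iff₀ hφ0]
    have := mul_le_mul_of_nonneg_left hNR (by norm_num : (0 : ℝ) ≤ 8)
    rw [mul_div_assoc'] at this
    exact (le_div_iff₀ hφ0).1 this
  linarith

/-- **READING 1 OF THE END (`R ≥ 1` on the run, `E₂ > 0`)**: the renewals cost `(8 ∕ E₂)·totalCostT`. [folklore] -/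
theorem ENT_leRC_E₂ (fat : ε → ℕ) (hE₂ : 0 < C.E₂) (hE₃ : 0 ≤ C.E₃) (hR1 : ∀ n, n ≤ K → 1 ≤ R n) (G : Gen ε)
    (hm : Mono st G) (hi : InjPartsR st fat G) (hf : FreshT G) (hc : ConsistentTLE sh C K R G) :
    ENT st G ≤ 2 * bsum (fun b => (1 : ℝ) + fat b) G + 4 * (partnerAges st G : ℝ) + 8 * mrg st G +
      8 / C.E₂ * totalCostT sh C K R G :=
  ENT_leRC st fat hE₂.le hE₃ hE₂ (fun n hn => E₂_le_floorK (C := C) hE₂.le hn (hR1 n hn)) G hm hi hf hc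

end Cost

/-! ### On pedigrees -/

section Pedigree

open HistoryGen

variable {α π : Type*} [DecidableEq α] [DecidableEq π] (P : HistoryGen.Pedigree α π)

/-- **ON A PEDIGREE**: `HeadOldest` (⇒ `Mono`), `Forest` (⇒ `FreshT`), the member's `ConsistentTLE` (H1b, by name) and
the order ∕ label display `InjPartsR`; floors `≥ φ > 0` on the run. [folklore] -/
theorem ENT_leRC_genT (hH : ∀ c, P.HeadOldest c) (hF : ∀ c, P.Forest c) (fatL : Lab α π → ℕ)
    {C : T4PrintedShapeBanking.Consts} {K : ℕ} {R : ℕ → ℕ} (hE₂ : 0 ≤ C.E₂) (hE₃ : 0 ≤ C.E₃) {φ : ℝ}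
    (hφ0 : 0 < φ) (hφ : ∀ n, n ≤ K → φ ≤ floorK C K R n) (c : α)
    (hi : InjPartsR (PEv.step ∘ Prod.fst) fatL (P.genT c)) (hc : ConsistentTLE Prod.fst C K R (P.genT c)) :
    ENT (PEv.step ∘ Prod.fst) (P.genT c) ≤
      2 * bsum (fun b => (1 : ℝ) + fatL b) (P.genT c) + 4 * (partnerAges (PEv.step ∘ Prod.fst) (P.genT c) : ℝ) +
        8 * mrg (PEv.step ∘ Prod.fst) (P.genT c) + 8 / φ * totalCostT Prod.fst C K R (P.genT c) :=
  ENT_leRC _ fatL hE₂ hE₃ hφ0 hφ _ (mono_genT P hH c) hi (Pedigree.freshT_genT hF c) hc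

/-- **ON A PEDIGREE, READING 1** (`R ≥ 1` on the run, `E₂ > 0`). [folklore] -/
theorem ENT_leRC_genT_E₂ (hH : ∀ c, P.HeadOldest c) (hF : ∀ c, P.Forest c) (fatL : Lab α π → ℕ)
    {C : T4PrintedShapeBanking.Consts} {K : ℕ} {R : ℕ → ℕ} (hE₂ : 0 < C.E₂) (hE₃ : 0 ≤ C.E₃)
    (hR1 : ∀ n, n ≤ K → 1 ≤ R n) (c : α)
    (hi : InjPartsR (PEv.step ∘ Prod.fst) fatL (P.genT c)) (hc : ConsistentTLE Prod.fst C K R (P.genT c)) :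
    ENT (PEv.step ∘ Prod.fst) (P.genT c) ≤
      2 * bsum (fun b => (1 : ℝ) + fatL b) (P.genT c) + 4 * (partnerAges (PEv.step ∘ Prod.fst) (P.genT c) : ℝ) +
        8 * mrg (PEv.step ∘ Prod.fst) (P.genT c) + 8 / C.E₂ * totalCostT Prod.fst C K R (P.genT c) :=
  ENT_leRC_E₂ _ fatL hE₂ hE₃ hR1 _ (mono_genT P hH c) hi (Pedigree.freshT_genT hF c) hc

/-- the renewal count of a forest member is at most its booked cost over the least performed floor (no entropy
display needed for this half). [folklore] -/
theorem NR_genT_le (hF : ∀ c, P.Forest c) {C : T4PrintedShapeBanking.Consts} {K : ℕ} {R : ℕ → ℕ}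
    (hE₂ : 0 ≤ C.E₂) (hE₃ : 0 ≤ C.E₃) {φ : ℝ} (hφ0 : 0 < φ) (hφ : ∀ n, n ≤ K → φ ≤ floorK C K R n) (c : α)
    (hc : ConsistentTLE Prod.fst C K R (P.genT c)) :
    (NR (PEv.step ∘ Prod.fst) (P.genT c) : ℝ) ≤ totalCostT Prod.fst C K R (P.genT c) / φ :=
  NR_le_totalCostT_div _ hE₂ hE₃ hφ0 hφ (Pedigree.freshT_genT hF c) hc

end Pedigree

/-! ## §4 Sanity: leaf-02's early renewal has one renewal node, paid by its booked cost -/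

namespace Sanity

open HistoryBankingLE.Sanity T4PrintedShapeBanking.XreadC4

/-- the structural count of the early renewal is `1` [folklore] -/
example : nrenew early = 1 := rfl

/-- the binding's count agrees [folklore] -/
example : NR (PEv.step ∘ Prod.fst) early = 1 := by rw [NR_eq_nrenew]; rfl

/-- the cost-side inequality instantiated at `R ≡ 2`, cutoff `K ≥ 3`: `1·E₂ ≤ totalCostT` [folklore] -/
example {K : ℕ} (hK : 3 ≤ K) : (nrenew early : ℝ) * C₀.E₂ ≤ totalCostT Prod.fst C₀ K (fun _ => 2) early :=
  nrenew_mul_E₂_le_totalCostT C₀_valid.E₂_nonneg C₀_valid.E₃_nonneg (fun _ _ => by norm_num) early_fresh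
    (early_consistentTLE hK)

end Sanity

end

end Summit.QuantumFields.BalabanUV.T4Continuum.HistoryRenewalsCost
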